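import Summits.Ventures.YMGap.Thresholds.OneLinkLevelTwoQuadEnvelope
import Summits.Ventures.YMGap.SlabAreaLaw
import Literature.MathematicalPhysics.QuantumFieldTheory.DurhuusFrohlichSlabCriterionProofs
import HarnessLib

/-!
# Venture YMGap — the one-link modulus beyond first order, part 39: Wilson AREA LAW rows of the level-two modulus `K₂Q`
# through the slab door — `HasAreaLaw d (fundamentalRep (Fin N)) (N·β)` for every `d ≥ 2`, every `N ≥ 4 / 6 / 10 / 20 / 50`

HONEST FRAMING: venture file of the cell `pub-ymgap` (QuantumFields programme), strong-coupling LATTICE statements for `SU(N)`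
lattice Yang–Mills on the `d`-dimensional torus (Wilson action, tree coupling `N·β`, 't Hooft `β`), volume-uniform finite-volume
area law `HasAreaLaw` (constructive-qft.S12); nothing about the continuum, the string tension's value, or the mass gap.  Kernel
ARITHMETIC over tree theorems, exactly as `OneLinkLevelTwoSDAreaLaw` (slab door `Slab.hasAreaLaw_of_oneLinkKRModulus` + the tree
theorem `durhuusFrohlich_areaLaw_of_slabClustering_holds`), with the modulus `oneLinkKRModulus_levelTwoQ` (`K₂Q`: ω-refined A-part,
quadratic words in `L²`; envelope `levelTwoQK_le`) in place of `K₂ˢ`: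
* `hasAreaLaw_SU_levelTwoQ_four (2 ≤ d) (4 ≤ N) (0 ≤ β) (2(d−1)β ≤ 11/40)`, `d = 4`: `β ≤ 11/240 = 0.0458` (`K₂ˢ`: `11/250`);
* `hasAreaLaw_SU_levelTwoQ_six (6 ≤ N) (2(d−1)β ≤ 59/200)`, `d = 4`: `β ≤ 59/1200 = 0.0492` (was `19/400`);
* `hasAreaLaw_SU_levelTwoQ_ten (10 ≤ N) (2(d−1)β ≤ 61/200)`, `d = 4`: `β ≤ 61/1200 = 0.0508` (was `49/1000`);
* `hasAreaLaw_SU_levelTwoQ_twenty (20 ≤ N) (2(d−1)β ≤ 31/100)`, `d = 4`: `β ≤ 31/600 = 0.0517` (was `1/20`);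
* `hasAreaLaw_SU_levelTwoQ_fifty (50 ≤ N) (2(d−1)β ≤ 5/16)`, `d = 4`: `β ≤ 5/96 = 0.0521`;
each with its `d = 4` instance `…_d4`, and `areaLaw_numbers_levelTwoQ`.  Printed Cao–Nissim–Sheffield (all `N`): `2(d−1)β < 1/4`,
`d = 4`: `1/24 ≈ 0.0417`.  Gain over the printed threshold in every dimension: `+10 % (N ≥ 4) | +18 % | +22 % | +24 % | +25 % (N ≥ 50)`.
CLASS: K (no hypothesis at all).  Exact rationals: cell folder `work/hier/al_pick_q.py` (margins `0.3–2.8 %`).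
-/

noncomputable section

open scoped Matrix ComplexConjugate BigOperators ContDiff Matrix.Norms.Frobenius
open Matrix Complex Finset MeasureTheory ProbabilityTheory
open Literature.MathematicalPhysics.QuantumLattice
open Literature.MathematicalPhysics.QuantumFieldTheory
open Literature.MathematicalPhysics.QuantumFieldTheory.SUNBakryEmery
open Literature.MathematicalPhysics.QuantumFieldTheory.Balaban1983to89.StrongCouplingDobrushinWindow
open Literature.MathematicalPhysics.QuantumFieldTheory.Balaban1983to89.StrongCouplingKernelWindow

namespace Summit.Ventures.YMGap.OneLinkEigen

variable {N : ℕ}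

section LevelTwoQAreaLaw

open Summit.Ventures.YMGap.Slab (hasAreaLaw_of_oneLinkKRModulus)

/-- **`SU(N)` Wilson AREA LAW in every dimension `d ≥ 2`, for every `N ≥ 4` and every 't Hooft `0 ≤ β` with `2(d−1)β ≤ 11 / 40`**
(`d = 4`: `β ≤ 11 / 240 = 0.0458`; printed Cao–Nissim–Sheffield `β < 1/(8(d−1))`) — hypothesis-free: the slab door with the level-two
one-link modulus `K₂Q` on the ball `R = 2(d−1)β` (`R·K₂Q(N,R) ≤ (11 / 40)·K̄₂Q(4, 11 / 40) < 1` by `levelTwoQK_le` and `norm_num`; `q = 1427 / 5000`,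
`p = 2331 / 2500`, `t = 3299 / 20000`) and the tree theorem `durhuusFrohlich_areaLaw_of_slabClustering_holds`. [cite: CaoNissimSheffield2025dynamical, Theorems 1.6 and 2.3] -/
theorem hasAreaLaw_SU_levelTwoQ_four {d : ℕ} (hd : 2 ≤ d) (hN : 4 ≤ N) {β : ℝ} (hβ : 0 ≤ β)
    (h : β * (2 * ((d : ℝ) - 1)) ≤ 11 / 40) : HasAreaLaw d (fundamentalRep (Fin N)) ((N : ℝ) * β) := by
  have hd1 : (0 : ℝ) ≤ (d : ℝ) - 1 := by
    have : (2 : ℝ) ≤ d := by exact_mod_cast hd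
    linarith
  obtain ⟨R, hRdef⟩ : ∃ R : ℝ, R = β * (2 * ((d : ℝ) - 1)) := ⟨_, rfl⟩
  have hR0 : 0 ≤ R := by rw [hRdef]; positivity
  have hRR₀ : R ≤ 11 / 40 := by rw [hRdef]; exact h
  have hR : R < 1 / 2 := by linarith
  have hN3 : 3 ≤ N := by omega
  have hK := levelTwoQK_le (N₀ := 4) (N := N) (by norm_num) hN (R := R) (R₀ := 11 / 40) (q := 1427 / 5000) (p := 2331 / 2500) (t := 3299 / 20000)
    hR0 hRR₀ (by norm_num) (by norm_num) (by norm_num) (by norm_num) (by norm_num) (by norm_num) (by norm_num)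
  have hK0 : 0 ≤ ((N : ℝ) ^ 2 / ((N : ℝ) ^ 2 - 1)) *
        (Real.sqrt ((1 +
            (2 * ((N : ℝ) * (2 * (N : ℝ) - 4 / N) / ((2 * (N : ℝ) - 4 / N) ^ 2 - 4)) *
            (R + (R ^ 2 / 2 + R * Real.sqrt (R ^ 2 / 4 + 1 / (N : ℝ) ^ 2)))
          + 2 * (2 * (N : ℝ) / ((2 * (N : ℝ) - 4 / N) ^ 2 - 4)) * N *
            ((R ^ 2 / 2 + R * Real.sqrt (R ^ 2 / 4 + 1 / (N : ℝ) ^ 2))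
              + R * (R / 2 + Real.sqrt (R ^ 2 / 4 + 1 / (N : ℝ) ^ 2)) ^ 2))) / 2)
          + ((N : ℝ) ^ 2 / (2 * ((N : ℝ) ^ 2 - 4))) * R + 2 * (((N : ℝ) ^ 2 / (2 * ((N : ℝ) ^ 2 - 4))) + 1 / 4) * (R ^ 2 / 2 + R * Real.sqrt (R ^ 2 / 4 + 1 / (N : ℝ) ^ 2))
          + (3 * ((N : ℝ) ^ 2 / (2 * ((N : ℝ) ^ 2 - 4))) * R ^ 2 + (2 * ((N : ℝ) ^ 2 / (2 * ((N : ℝ) ^ 2 - 4))) + 1 / 4) * (R * ((R ^ 2 * (1 + R / 2 + Real.sqrt (R ^ 2 / 4 + 1 / (N : ℝ) ^ 2)) / (2 - 4 / (N : ℝ) ^ 2)) / 2 + Real.sqrt ((R ^ 2 * (1 + R / 2 + Real.sqrt (R ^ 2 / 4 + 1 / (N : ℝ) ^ 2)) / (2 - 4 / (N : ℝ) ^ 2)) ^ 2 / 4 + (R ^ 2 * (4 / (N : ℝ) ^ 2 + 2 * (R / 2 + Real.sqrt (R ^ 2 / 4 + 1 / (N : ℝ) ^ 2)) ^ 2) /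 (2 - 4 / (N : ℝ) ^ 2)))))
              + (10 * ((N : ℝ) ^ 2 / (2 * ((N : ℝ) ^ 2 - 4))) + 1 / 2) * R * (R ^ 2 / 2 + R * Real.sqrt (R ^ 2 / 4 + 1 / (N : ℝ) ^ 2))) / (1 / 2 - R)) := by
    have h10 : (3 : ℝ) ≤ N := by exact_mod_cast hN3
    have hN4 : (0 : ℝ) < (N : ℝ) ^ 2 - 4 := by nlinarith only [h10]
    have hN1 : (0 : ℝ) < (N : ℝ) ^ 2 - 1 := by nlinarith only [h10]
    have : 0 ≤ (N : ℝ) ^ 2 / ((N : ℝ) ^ 2 - 1) := div_nonneg (by positivity) hN1.le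
    have : 0 ≤ (N : ℝ) ^ 2 / (2 * ((N : ℝ) ^ 2 - 4)) := div_nonneg (by positivity) (by positivity)
    have : 0 < 1 / 2 - R := by linarith only [hR]
    have : 0 ≤ (R * ((R ^ 2 * (1 + R / 2 + Real.sqrt (R ^ 2 / 4 + 1 / (N : ℝ) ^ 2)) / (2 - 4 / (N : ℝ) ^ 2)) / 2 + Real.sqrt ((R ^ 2 * (1 + R / 2 + Real.sqrt (R ^ 2 / 4 + 1 / (N : ℝ) ^ 2)) / (2 - 4 / (N : ℝ) ^ 2)) ^ 2 / 4 + (R ^ 2 * (4 / (N : ℝ) ^ 2 + 2 * (R / 2 + Real.sqrt (R ^ 2 / 4 + 1 / (N : ℝ) ^ 2)) ^ 2) / (2 - 4 / (N : ℝ) ^ 2))))) := tau_nonneg hN3 hR0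
    positivity
  refine hasAreaLaw_of_oneLinkKRModulus durhuusFrohlich_areaLaw_of_slabClustering_holds hd (by omega) hβ hK0 hRdef.symm.le
    (oneLinkKRModulus_levelTwoQ hN3 hR) ?_
  have hnum : ((4 : ℝ) ^ 2 / ((4 : ℝ) ^ 2 - 1)) *
        ((2331 / 2500) + ((4 : ℝ) ^ 2 / (2 * ((4 : ℝ) ^ 2 - 4))) * (11 / 40) + 2 * (((4 : ℝ) ^ 2 / (2 * ((4 : ℝ) ^ 2 - 4))) + 1 / 4) * ((11 / 40) ^ 2 / 2 + (11 / 40) * (1427 / 5000))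
          + (3 * ((4 : ℝ) ^ 2 / (2 * ((4 : ℝ) ^ 2 - 4))) * (11 / 40) ^ 2 + (2 * ((4 : ℝ) ^ 2 / (2 * ((4 : ℝ) ^ 2 - 4))) + 1 / 4) * ((11 / 40) * (((11 / 40) ^ 2 * (1 + (11 / 40) / 2 + (1427 / 5000)) / (2 - 4 / (4 : ℝ) ^ 2)) / 2 + (3299 / 20000)))
              + (10 * ((4 : ℝ) ^ 2 / (2 * ((4 : ℝ) ^ 2 - 4))) + 1 / 2) * (11 / 40) * ((11 / 40) ^ 2 / 2 + (11 / 40) * (1427 / 5000))) / (1 / 2 - (11 / 40))) * (11 / 40) < 1 := by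
    norm_num
  have e : 2 * ((d : ℝ) - 1) * β = R := by rw [hRdef]; ring
  rw [e]
  push_cast at hK
  nlinarith [mul_le_mul hK hRR₀ hR0 (by norm_num), hK0]

/-- `d = 4`: **`SU(N)` Wilson AREA LAW for every `N ≥ 4` at every 't Hooft `0 ≤ β ≤ 11 / 240`** (`0.0458`; tree coupling `N·β`;
printed Cao–Nissim–Sheffield: `β < 1/24 ≈ 0.0417`), hypothesis-free. [cite: CaoNissimSheffield2025dynamical, Theorems 1.6 and 2.3] -/
theorem hasAreaLaw_SU_levelTwoQ_four_d4 (hN : 4 ≤ N) {β : ℝ} (hβ : 0 ≤ β) (h : β ≤ 11 / 240) :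
    HasAreaLaw 4 (fundamentalRep (Fin N)) ((N : ℝ) * β) :=
  hasAreaLaw_SU_levelTwoQ_four (d := 4) (by norm_num) hN hβ (by norm_num; linarith)

/-- **`SU(N)` Wilson AREA LAW in every dimension `d ≥ 2`, for every `N ≥ 6` and every 't Hooft `0 ≤ β` with `2(d−1)β ≤ 59 / 200`**
(`d = 4`: `β ≤ 59 / 1200 = 0.0492`; printed Cao–Nissim–Sheffield `β < 1/(8(d−1))`) — hypothesis-free: the slab door with the level-two
one-link modulus `K₂Q` on the ball `R = 2(d−1)β` (`R·K₂Q(N,R) ≤ (59 / 200)·K̄₂Q(6, 59 / 200) < 1` by `levelTwoQK_le` and `norm_num`; `q = 1113 / 5000`,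
`p = 562 / 625`, `t = 13689 / 100000`) and the tree theorem `durhuusFrohlich_areaLaw_of_slabClustering_holds`. [cite: CaoNissimSheffield2025dynamical, Theorems 1.6 and 2.3] -/
theorem hasAreaLaw_SU_levelTwoQ_six {d : ℕ} (hd : 2 ≤ d) (hN : 6 ≤ N) {β : ℝ} (hβ : 0 ≤ β)
    (h : β * (2 * ((d : ℝ) - 1)) ≤ 59 / 200) : HasAreaLaw d (fundamentalRep (Fin N)) ((N : ℝ) * β) := by
  have hd1 : (0 : ℝ) ≤ (d : ℝ) - 1 := by
    have : (2 : ℝ) ≤ d := by exact_mod_cast hd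
    linarith
  obtain ⟨R, hRdef⟩ : ∃ R : ℝ, R = β * (2 * ((d : ℝ) - 1)) := ⟨_, rfl⟩
  have hR0 : 0 ≤ R := by rw [hRdef]; positivity
  have hRR₀ : R ≤ 59 / 200 := by rw [hRdef]; exact h
  have hR : R < 1 / 2 := by linarith
  have hN3 : 3 ≤ N := by omega
  have hK := levelTwoQK_le (N₀ := 6) (N := N) (by norm_num) hN (R := R) (R₀ := 59 / 200) (q := 1113 / 5000) (p := 562 / 625) (t := 13689 / 100000)
    hR0 hRR₀ (by norm_num) (by norm_num) (by norm_num) (by norm_num) (by norm_num) (by norm_num) (by norm_num)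
  have hK0 : 0 ≤ ((N : ℝ) ^ 2 / ((N : ℝ) ^ 2 - 1)) *
        (Real.sqrt ((1 +
            (2 * ((N : ℝ) * (2 * (N : ℝ) - 4 / N) / ((2 * (N : ℝ) - 4 / N) ^ 2 - 4)) *
            (R + (R ^ 2 / 2 + R * Real.sqrt (R ^ 2 / 4 + 1 / (N : ℝ) ^ 2)))
          + 2 * (2 * (N : ℝ) / ((2 * (N : ℝ) - 4 / N) ^ 2 - 4)) * N *
            ((R ^ 2 / 2 + R * Real.sqrt (R ^ 2 / 4 + 1 / (N : ℝ) ^ 2))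
              + R * (R / 2 + Real.sqrt (R ^ 2 / 4 + 1 / (N : ℝ) ^ 2)) ^ 2))) / 2)
          + ((N : ℝ) ^ 2 / (2 * ((N : ℝ) ^ 2 - 4))) * R + 2 * (((N : ℝ) ^ 2 / (2 * ((N : ℝ) ^ 2 - 4))) + 1 / 4) * (R ^ 2 / 2 + R * Real.sqrt (R ^ 2 / 4 + 1 / (N : ℝ) ^ 2))
          + (3 * ((N : ℝ) ^ 2 / (2 * ((N : ℝ) ^ 2 - 4))) * R ^ 2 + (2 * ((N : ℝ) ^ 2 / (2 * ((N : ℝ) ^ 2 - 4))) + 1 / 4) * (R * ((R ^ 2 * (1 + R / 2 + Real.sqrt (R ^ 2 / 4 + 1 / (N : ℝ) ^ 2)) / (2 - 4 / (N : ℝ) ^ 2)) / 2 + Real.sqrt ((R ^ 2 * (1 + R / 2 + Real.sqrt (R ^ 2 / 4 + 1 / (N : ℝ) ^ 2)) / (2 - 4 / (N : ℝ) ^ 2)) ^ 2 / 4 + (R ^ 2 * (4 / (N : ℝ) ^ 2 + 2 * (R / 2 + Real.sqrt (R ^ 2 / 4 + 1 / (N : ℝ) ^ 2)) ^ 2) /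 (2 - 4 / (N : ℝ) ^ 2)))))
              + (10 * ((N : ℝ) ^ 2 / (2 * ((N : ℝ) ^ 2 - 4))) + 1 / 2) * R * (R ^ 2 / 2 + R * Real.sqrt (R ^ 2 / 4 + 1 / (N : ℝ) ^ 2))) / (1 / 2 - R)) := by
    have h10 : (3 : ℝ) ≤ N := by exact_mod_cast hN3
    have hN4 : (0 : ℝ) < (N : ℝ) ^ 2 - 4 := by nlinarith only [h10]
    have hN1 : (0 : ℝ) < (N : ℝ) ^ 2 - 1 := by nlinarith only [h10]
    have : 0 ≤ (N : ℝ) ^ 2 / ((N : ℝ) ^ 2 - 1) := div_nonneg (by positivity) hN1.le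
    have : 0 ≤ (N : ℝ) ^ 2 / (2 * ((N : ℝ) ^ 2 - 4)) := div_nonneg (by positivity) (by positivity)
    have : 0 < 1 / 2 - R := by linarith only [hR]
    have : 0 ≤ (R * ((R ^ 2 * (1 + R / 2 + Real.sqrt (R ^ 2 / 4 + 1 / (N : ℝ) ^ 2)) / (2 - 4 / (N : ℝ) ^ 2)) / 2 + Real.sqrt ((R ^ 2 * (1 + R / 2 + Real.sqrt (R ^ 2 / 4 + 1 / (N : ℝ) ^ 2)) / (2 - 4 / (N : ℝ) ^ 2)) ^ 2 / 4 + (R ^ 2 * (4 / (N : ℝ) ^ 2 + 2 * (R / 2 + Real.sqrt (R ^ 2 / 4 + 1 / (N : ℝ) ^ 2)) ^ 2) / (2 - 4 / (N : ℝ) ^ 2))))) := tau_nonneg hN3 hR0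
    positivity
  refine hasAreaLaw_of_oneLinkKRModulus durhuusFrohlich_areaLaw_of_slabClustering_holds hd (by omega) hβ hK0 hRdef.symm.le
    (oneLinkKRModulus_levelTwoQ hN3 hR) ?_
  have hnum : ((6 : ℝ) ^ 2 / ((6 : ℝ) ^ 2 - 1)) *
        ((562 / 625) + ((6 : ℝ) ^ 2 / (2 * ((6 : ℝ) ^ 2 - 4))) * (59 / 200) + 2 * (((6 : ℝ) ^ 2 / (2 * ((6 : ℝ) ^ 2 - 4))) + 1 / 4) * ((59 / 200) ^ 2 / 2 + (59 / 200) * (1113 / 5000))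
          + (3 * ((6 : ℝ) ^ 2 / (2 * ((6 : ℝ) ^ 2 - 4))) * (59 / 200) ^ 2 + (2 * ((6 : ℝ) ^ 2 / (2 * ((6 : ℝ) ^ 2 - 4))) + 1 / 4) * ((59 / 200) * (((59 / 200) ^ 2 * (1 + (59 / 200) / 2 + (1113 / 5000)) / (2 - 4 / (6 : ℝ) ^ 2)) / 2 + (13689 / 100000)))
              + (10 * ((6 : ℝ) ^ 2 / (2 * ((6 : ℝ) ^ 2 - 4))) + 1 / 2) * (59 / 200) * ((59 / 200) ^ 2 / 2 + (59 / 200) * (1113 / 5000))) / (1 / 2 - (59 / 200))) * (59 / 200) < 1 := by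
    norm_num
  have e : 2 * ((d : ℝ) - 1) * β = R := by rw [hRdef]; ring
  rw [e]
  push_cast at hK
  nlinarith [mul_le_mul hK hRR₀ hR0 (by norm_num), hK0]

/-- `d = 4`: **`SU(N)` Wilson AREA LAW for every `N ≥ 6` at every 't Hooft `0 ≤ β ≤ 59 / 1200`** (`0.0492`; tree coupling `N·β`;
printed Cao–Nissim–Sheffield: `β < 1/24 ≈ 0.0417`), hypothesis-free. [cite: CaoNissimSheffield2025dynamical, Theorems 1.6 and 2.3] -/
theorem hasAreaLaw_SU_levelTwoQ_six_d4 (hN : 6 ≤ N) {β : ℝ} (hβ : 0 ≤ β) (h : β ≤ 59 / 1200) :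
    HasAreaLaw 4 (fundamentalRep (Fin N)) ((N : ℝ) * β) :=
  hasAreaLaw_SU_levelTwoQ_six (d := 4) (by norm_num) hN hβ (by norm_num; linarith)

/-- **`SU(N)` Wilson AREA LAW in every dimension `d ≥ 2`, for every `N ≥ 10` and every 't Hooft `0 ≤ β` with `2(d−1)β ≤ 61 / 200`**
(`d = 4`: `β ≤ 61 / 1200 = 0.0508`; printed Cao–Nissim–Sheffield `β < 1/(8(d−1))`) — hypothesis-free: the slab door with the level-two
one-link modulus `K₂Q` on the ball `R = 2(d−1)β` (`R·K₂Q(N,R) ≤ (61 / 200)·K̄₂Q(10, 61 / 200) < 1` by `levelTwoQK_le` and `norm_num`; `q = 114 / 625`,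
`p = 4421 / 5000`, `t = 291 / 2500`) and the tree theorem `durhuusFrohlich_areaLaw_of_slabClustering_holds`. [cite: CaoNissimSheffield2025dynamical, Theorems 1.6 and 2.3] -/
theorem hasAreaLaw_SU_levelTwoQ_ten {d : ℕ} (hd : 2 ≤ d) (hN : 10 ≤ N) {β : ℝ} (hβ : 0 ≤ β)
    (h : β * (2 * ((d : ℝ) - 1)) ≤ 61 / 200) : HasAreaLaw d (fundamentalRep (Fin N)) ((N : ℝ) * β) := by
  have hd1 : (0 : ℝ) ≤ (d : ℝ) - 1 := by
    have : (2 : ℝ) ≤ d := by exact_mod_cast hd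
    linarith
  obtain ⟨R, hRdef⟩ : ∃ R : ℝ, R = β * (2 * ((d : ℝ) - 1)) := ⟨_, rfl⟩
  have hR0 : 0 ≤ R := by rw [hRdef]; positivity
  have hRR₀ : R ≤ 61 / 200 := by rw [hRdef]; exact h
  have hR : R < 1 / 2 := by linarith
  have hN3 : 3 ≤ N := by omega
  have hK := levelTwoQK_le (N₀ := 10) (N := N) (by norm_num) hN (R := R) (R₀ := 61 / 200) (q := 114 / 625) (p := 4421 / 5000) (t := 291 / 2500)
    hR0 hRR₀ (by norm_num) (by norm_num) (by norm_num) (by norm_num) (by norm_num) (by norm_num) (by norm_num)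
  have hK0 : 0 ≤ ((N : ℝ) ^ 2 / ((N : ℝ) ^ 2 - 1)) *
        (Real.sqrt ((1 +
            (2 * ((N : ℝ) * (2 * (N : ℝ) - 4 / N) / ((2 * (N : ℝ) - 4 / N) ^ 2 - 4)) *
            (R + (R ^ 2 / 2 + R * Real.sqrt (R ^ 2 / 4 + 1 / (N : ℝ) ^ 2)))
          + 2 * (2 * (N : ℝ) / ((2 * (N : ℝ) - 4 / N) ^ 2 - 4)) * N *
            ((R ^ 2 / 2 + R * Real.sqrt (R ^ 2 / 4 + 1 / (N : ℝ) ^ 2))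
              + R * (R / 2 + Real.sqrt (R ^ 2 / 4 + 1 / (N : ℝ) ^ 2)) ^ 2))) / 2)
          + ((N : ℝ) ^ 2 / (2 * ((N : ℝ) ^ 2 - 4))) * R + 2 * (((N : ℝ) ^ 2 / (2 * ((N : ℝ) ^ 2 - 4))) + 1 / 4) * (R ^ 2 / 2 + R * Real.sqrt (R ^ 2 / 4 + 1 / (N : ℝ) ^ 2))
          + (3 * ((N : ℝ) ^ 2 / (2 * ((N : ℝ) ^ 2 - 4))) * R ^ 2 + (2 * ((N : ℝ) ^ 2 / (2 * ((N : ℝ) ^ 2 - 4))) + 1 / 4) * (R * ((R ^ 2 * (1 + R / 2 + Real.sqrt (R ^ 2 / 4 + 1 / (N : ℝ) ^ 2)) / (2 - 4 / (N : ℝ) ^ 2)) / 2 + Real.sqrt ((R ^ 2 * (1 + R / 2 + Real.sqrt (R ^ 2 / 4 + 1 / (N : ℝ) ^ 2)) / (2 - 4 / (N : ℝ) ^ 2)) ^ 2 / 4 + (R ^ 2 * (4 / (N : ℝ) ^ 2 + 2 * (R / 2 + Real.sqrt (R ^ 2 / 4 + 1 / (N : ℝ) ^ 2)) ^ 2) /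 (2 - 4 / (N : ℝ) ^ 2)))))
              + (10 * ((N : ℝ) ^ 2 / (2 * ((N : ℝ) ^ 2 - 4))) + 1 / 2) * R * (R ^ 2 / 2 + R * Real.sqrt (R ^ 2 / 4 + 1 / (N : ℝ) ^ 2))) / (1 / 2 - R)) := by
    have h10 : (3 : ℝ) ≤ N := by exact_mod_cast hN3
    have hN4 : (0 : ℝ) < (N : ℝ) ^ 2 - 4 := by nlinarith only [h10]
    have hN1 : (0 : ℝ) < (N : ℝ) ^ 2 - 1 := by nlinarith only [h10]
    have : 0 ≤ (N : ℝ) ^ 2 / ((N : ℝ) ^ 2 - 1) := div_nonneg (by positivity) hN1.le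
    have : 0 ≤ (N : ℝ) ^ 2 / (2 * ((N : ℝ) ^ 2 - 4)) := div_nonneg (by positivity) (by positivity)
    have : 0 < 1 / 2 - R := by linarith only [hR]
    have : 0 ≤ (R * ((R ^ 2 * (1 + R / 2 + Real.sqrt (R ^ 2 / 4 + 1 / (N : ℝ) ^ 2)) / (2 - 4 / (N : ℝ) ^ 2)) / 2 + Real.sqrt ((R ^ 2 * (1 + R / 2 + Real.sqrt (R ^ 2 / 4 + 1 / (N : ℝ) ^ 2)) / (2 - 4 / (N : ℝ) ^ 2)) ^ 2 / 4 + (R ^ 2 * (4 / (N : ℝ) ^ 2 + 2 * (R / 2 + Real.sqrt (R ^ 2 / 4 + 1 / (N : ℝ) ^ 2)) ^ 2) / (2 - 4 / (N : ℝ) ^ 2))))) := tau_nonneg hN3 hR0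
    positivity
  refine hasAreaLaw_of_oneLinkKRModulus durhuusFrohlich_areaLaw_of_slabClustering_holds hd (by omega) hβ hK0 hRdef.symm.le
    (oneLinkKRModulus_levelTwoQ hN3 hR) ?_
  have hnum : ((10 : ℝ) ^ 2 / ((10 : ℝ) ^ 2 - 1)) *
        ((4421 / 5000) + ((10 : ℝ) ^ 2 / (2 * ((10 : ℝ) ^ 2 - 4))) * (61 / 200) + 2 * (((10 : ℝ) ^ 2 / (2 * ((10 : ℝ) ^ 2 - 4))) + 1 / 4) * ((61 / 200) ^ 2 / 2 + (61 / 200) * (114 / 625))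
          + (3 * ((10 : ℝ) ^ 2 / (2 * ((10 : ℝ) ^ 2 - 4))) * (61 / 200) ^ 2 + (2 * ((10 : ℝ) ^ 2 / (2 * ((10 : ℝ) ^ 2 - 4))) + 1 / 4) * ((61 / 200) * (((61 / 200) ^ 2 * (1 + (61 / 200) / 2 + (114 / 625)) / (2 - 4 / (10 : ℝ) ^ 2)) / 2 + (291 / 2500)))
              + (10 * ((10 : ℝ) ^ 2 / (2 * ((10 : ℝ) ^ 2 - 4))) + 1 / 2) * (61 / 200) * ((61 / 200) ^ 2 / 2 + (61 / 200) * (114 / 625))) / (1 / 2 - (61 / 200))) * (61 / 200) < 1 := by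
    norm_num
  have e : 2 * ((d : ℝ) - 1) * β = R := by rw [hRdef]; ring
  rw [e]
  push_cast at hK
  nlinarith [mul_le_mul hK hRR₀ hR0 (by norm_num), hK0]

/-- `d = 4`: **`SU(N)` Wilson AREA LAW for every `N ≥ 10` at every 't Hooft `0 ≤ β ≤ 61 / 1200`** (`0.0508`; tree coupling `N·β`;
printed Cao–Nissim–Sheffield: `β < 1/24 ≈ 0.0417`), hypothesis-free. [cite: CaoNissimSheffield2025dynamical, Theorems 1.6 and 2.3] -/
theorem hasAreaLaw_SU_levelTwoQ_ten_d4 (hN : 10 ≤ N) {β : ℝ} (hβ : 0 ≤ β) (h : β ≤ 61 / 1200) :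
    HasAreaLaw 4 (fundamentalRep (Fin N)) ((N : ℝ) * β) :=
  hasAreaLaw_SU_levelTwoQ_ten (d := 4) (by norm_num) hN hβ (by norm_num; linarith)

/-- **`SU(N)` Wilson AREA LAW in every dimension `d ≥ 2`, for every `N ≥ 20` and every 't Hooft `0 ≤ β` with `2(d−1)β ≤ 31 / 100`**
(`d = 4`: `β ≤ 31 / 600 = 0.0517`; printed Cao–Nissim–Sheffield `β < 1/(8(d−1))`) — hypothesis-free: the slab door with the level-two
one-link modulus `K₂Q` on the ball `R = 2(d−1)β` (`R·K₂Q(N,R) ≤ (31 / 100)·K̄₂Q(20, 31 / 100) < 1` by `levelTwoQK_le` and `norm_num`; `q = 1629 / 10000`,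
`p = 1757 / 2000`, `t = 1061 / 10000`) and the tree theorem `durhuusFrohlich_areaLaw_of_slabClustering_holds`. [cite: CaoNissimSheffield2025dynamical, Theorems 1.6 and 2.3] -/
theorem hasAreaLaw_SU_levelTwoQ_twenty {d : ℕ} (hd : 2 ≤ d) (hN : 20 ≤ N) {β : ℝ} (hβ : 0 ≤ β)
    (h : β * (2 * ((d : ℝ) - 1)) ≤ 31 / 100) : HasAreaLaw d (fundamentalRep (Fin N)) ((N : ℝ) * β) := by
  have hd1 : (0 : ℝ) ≤ (d : ℝ) - 1 := by
    have : (2 : ℝ) ≤ d := by exact_mod_cast hd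
    linarith
  obtain ⟨R, hRdef⟩ : ∃ R : ℝ, R = β * (2 * ((d : ℝ) - 1)) := ⟨_, rfl⟩
  have hR0 : 0 ≤ R := by rw [hRdef]; positivity
  have hRR₀ : R ≤ 31 / 100 := by rw [hRdef]; exact h
  have hR : R < 1 / 2 := by linarith
  have hN3 : 3 ≤ N := by omega
  have hK := levelTwoQK_le (N₀ := 20) (N := N) (by norm_num) hN (R := R) (R₀ := 31 / 100) (q := 1629 / 10000) (p := 1757 / 2000) (t := 1061 / 10000)
    hR0 hRR₀ (by norm_num) (by norm_num) (by norm_num) (by norm_num) (by norm_num) (by norm_num) (by norm_num)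
  have hK0 : 0 ≤ ((N : ℝ) ^ 2 / ((N : ℝ) ^ 2 - 1)) *
        (Real.sqrt ((1 +
            (2 * ((N : ℝ) * (2 * (N : ℝ) - 4 / N) / ((2 * (N : ℝ) - 4 / N) ^ 2 - 4)) *
            (R + (R ^ 2 / 2 + R * Real.sqrt (R ^ 2 / 4 + 1 / (N : ℝ) ^ 2)))
          + 2 * (2 * (N : ℝ) / ((2 * (N : ℝ) - 4 / N) ^ 2 - 4)) * N *
            ((R ^ 2 / 2 + R * Real.sqrt (R ^ 2 / 4 + 1 / (N : ℝ) ^ 2))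
              + R * (R / 2 + Real.sqrt (R ^ 2 / 4 + 1 / (N : ℝ) ^ 2)) ^ 2))) / 2)
          + ((N : ℝ) ^ 2 / (2 * ((N : ℝ) ^ 2 - 4))) * R + 2 * (((N : ℝ) ^ 2 / (2 * ((N : ℝ) ^ 2 - 4))) + 1 / 4) * (R ^ 2 / 2 + R * Real.sqrt (R ^ 2 / 4 + 1 / (N : ℝ) ^ 2))
          + (3 * ((N : ℝ) ^ 2 / (2 * ((N : ℝ) ^ 2 - 4))) * R ^ 2 + (2 * ((N : ℝ) ^ 2 / (2 * ((N : ℝ) ^ 2 - 4))) + 1 / 4) * (R * ((R ^ 2 * (1 + R / 2 + Real.sqrt (R ^ 2 / 4 + 1 / (N : ℝ) ^ 2)) / (2 - 4 / (N : ℝ) ^ 2)) / 2 + Real.sqrt ((R ^ 2 * (1 + R / 2 + Real.sqrt (R ^ 2 / 4 + 1 / (N : ℝ) ^ 2)) / (2 - 4 / (N : ℝ) ^ 2)) ^ 2 / 4 + (R ^ 2 * (4 / (N : ℝ) ^ 2 + 2 * (R / 2 + Real.sqrt (R ^ 2 / 4 + 1 / (N : ℝ) ^ 2)) ^ 2) /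 (2 - 4 / (N : ℝ) ^ 2)))))
              + (10 * ((N : ℝ) ^ 2 / (2 * ((N : ℝ) ^ 2 - 4))) + 1 / 2) * R * (R ^ 2 / 2 + R * Real.sqrt (R ^ 2 / 4 + 1 / (N : ℝ) ^ 2))) / (1 / 2 - R)) := by
    have h10 : (3 : ℝ) ≤ N := by exact_mod_cast hN3
    have hN4 : (0 : ℝ) < (N : ℝ) ^ 2 - 4 := by nlinarith only [h10]
    have hN1 : (0 : ℝ) < (N : ℝ) ^ 2 - 1 := by nlinarith only [h10]
    have : 0 ≤ (N : ℝ) ^ 2 / ((N : ℝ) ^ 2 - 1) := div_nonneg (by positivity) hN1.le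
    have : 0 ≤ (N : ℝ) ^ 2 / (2 * ((N : ℝ) ^ 2 - 4)) := div_nonneg (by positivity) (by positivity)
    have : 0 < 1 / 2 - R := by linarith only [hR]
    have : 0 ≤ (R * ((R ^ 2 * (1 + R / 2 + Real.sqrt (R ^ 2 / 4 + 1 / (N : ℝ) ^ 2)) / (2 - 4 / (N : ℝ) ^ 2)) / 2 + Real.sqrt ((R ^ 2 * (1 + R / 2 + Real.sqrt (R ^ 2 / 4 + 1 / (N : ℝ) ^ 2)) / (2 - 4 / (N : ℝ) ^ 2)) ^ 2 / 4 + (R ^ 2 * (4 / (N : ℝ) ^ 2 + 2 * (R / 2 + Real.sqrt (R ^ 2 / 4 + 1 / (N : ℝ) ^ 2)) ^ 2) / (2 - 4 / (N : ℝ) ^ 2))))) := tau_nonneg hN3 hR0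
    positivity
  refine hasAreaLaw_of_oneLinkKRModulus durhuusFrohlich_areaLaw_of_slabClustering_holds hd (by omega) hβ hK0 hRdef.symm.le
    (oneLinkKRModulus_levelTwoQ hN3 hR) ?_
  have hnum : ((20 : ℝ) ^ 2 / ((20 : ℝ) ^ 2 - 1)) *
        ((1757 / 2000) + ((20 : ℝ) ^ 2 / (2 * ((20 : ℝ) ^ 2 - 4))) * (31 / 100) + 2 * (((20 : ℝ) ^ 2 / (2 * ((20 : ℝ) ^ 2 - 4))) + 1 / 4) * ((31 / 100) ^ 2 / 2 + (31 / 100) * (1629 / 10000))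
          + (3 * ((20 : ℝ) ^ 2 / (2 * ((20 : ℝ) ^ 2 - 4))) * (31 / 100) ^ 2 + (2 * ((20 : ℝ) ^ 2 / (2 * ((20 : ℝ) ^ 2 - 4))) + 1 / 4) * ((31 / 100) * (((31 / 100) ^ 2 * (1 + (31 / 100) / 2 + (1629 / 10000)) / (2 - 4 / (20 : ℝ) ^ 2)) / 2 + (1061 / 10000)))
              + (10 * ((20 : ℝ) ^ 2 / (2 * ((20 : ℝ) ^ 2 - 4))) + 1 / 2) * (31 / 100) * ((31 / 100) ^ 2 / 2 + (31 / 100) * (1629 / 10000))) / (1 / 2 - (31 / 100))) * (31 / 100) < 1 := by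
    norm_num
  have e : 2 * ((d : ℝ) - 1) * β = R := by rw [hRdef]; ring
  rw [e]
  push_cast at hK
  nlinarith [mul_le_mul hK hRR₀ hR0 (by norm_num), hK0]

/-- `d = 4`: **`SU(N)` Wilson AREA LAW for every `N ≥ 20` at every 't Hooft `0 ≤ β ≤ 31 / 600`** (`0.0517`; tree coupling `N·β`;
printed Cao–Nissim–Sheffield: `β < 1/24 ≈ 0.0417`), hypothesis-free. [cite: CaoNissimSheffield2025dynamical, Theorems 1.6 and 2.3] -/
theorem hasAreaLaw_SU_levelTwoQ_twenty_d4 (hN : 20 ≤ N) {β : ℝ} (hβ : 0 ≤ β) (h : β ≤ 31 / 600) :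
    HasAreaLaw 4 (fundamentalRep (Fin N)) ((N : ℝ) * β) :=
  hasAreaLaw_SU_levelTwoQ_twenty (d := 4) (by norm_num) hN hβ (by norm_num; linarith)

/-- **`SU(N)` Wilson AREA LAW in every dimension `d ≥ 2`, for every `N ≥ 50` and every 't Hooft `0 ≤ β` with `2(d−1)β ≤ 5 / 16`**
(`d = 4`: `β ≤ 5 / 96 = 0.0521`; printed Cao–Nissim–Sheffield `β < 1/(8(d−1))`) — hypothesis-free: the slab door with the level-two
one-link modulus `K₂Q` on the ball `R = 2(d−1)β` (`R·K₂Q(N,R) ≤ (5 / 16)·K̄₂Q(50, 5 / 16) < 1` by `levelTwoQK_le` and `norm_num`; `q = 197 / 1250`,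
`p = 1097 / 1250`, `t = 5181 / 50000`) and the tree theorem `durhuusFrohlich_areaLaw_of_slabClustering_holds`. [cite: CaoNissimSheffield2025dynamical, Theorems 1.6 and 2.3] -/
theorem hasAreaLaw_SU_levelTwoQ_fifty {d : ℕ} (hd : 2 ≤ d) (hN : 50 ≤ N) {β : ℝ} (hβ : 0 ≤ β)
    (h : β * (2 * ((d : ℝ) - 1)) ≤ 5 / 16) : HasAreaLaw d (fundamentalRep (Fin N)) ((N : ℝ) * β) := by
  have hd1 : (0 : ℝ) ≤ (d : ℝ) - 1 := by
    have : (2 : ℝ) ≤ d := by exact_mod_cast hd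
    linarith
  obtain ⟨R, hRdef⟩ : ∃ R : ℝ, R = β * (2 * ((d : ℝ) - 1)) := ⟨_, rfl⟩
  have hR0 : 0 ≤ R := by rw [hRdef]; positivity
  have hRR₀ : R ≤ 5 / 16 := by rw [hRdef]; exact h
  have hR : R < 1 / 2 := by linarith
  have hN3 : 3 ≤ N := by omega
  have hK := levelTwoQK_le (N₀ := 50) (N := N) (by norm_num) hN (R := R) (R₀ := 5 / 16) (q := 197 / 1250) (p := 1097 / 1250) (t := 5181 / 50000)
    hR0 hRR₀ (by norm_num) (by norm_num) (by norm_num) (by norm_num) (by norm_num) (by norm_num) (by norm_num)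
  have hK0 : 0 ≤ ((N : ℝ) ^ 2 / ((N : ℝ) ^ 2 - 1)) *
        (Real.sqrt ((1 +
            (2 * ((N : ℝ) * (2 * (N : ℝ) - 4 / N) / ((2 * (N : ℝ) - 4 / N) ^ 2 - 4)) *
            (R + (R ^ 2 / 2 + R * Real.sqrt (R ^ 2 / 4 + 1 / (N : ℝ) ^ 2)))
          + 2 * (2 * (N : ℝ) / ((2 * (N : ℝ) - 4 / N) ^ 2 - 4)) * N *
            ((R ^ 2 / 2 + R * Real.sqrt (R ^ 2 / 4 + 1 / (N : ℝ) ^ 2))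
              + R * (R / 2 + Real.sqrt (R ^ 2 / 4 + 1 / (N : ℝ) ^ 2)) ^ 2))) / 2)
          + ((N : ℝ) ^ 2 / (2 * ((N : ℝ) ^ 2 - 4))) * R + 2 * (((N : ℝ) ^ 2 / (2 * ((N : ℝ) ^ 2 - 4))) + 1 / 4) * (R ^ 2 / 2 + R * Real.sqrt (R ^ 2 / 4 + 1 / (N : ℝ) ^ 2))
          + (3 * ((N : ℝ) ^ 2 / (2 * ((N : ℝ) ^ 2 - 4))) * R ^ 2 + (2 * ((N : ℝ) ^ 2 / (2 * ((N : ℝ) ^ 2 - 4))) + 1 / 4) * (R * ((R ^ 2 * (1 + R / 2 + Real.sqrt (R ^ 2 / 4 + 1 / (N : ℝ) ^ 2)) / (2 - 4 / (N : ℝ) ^ 2)) / 2 + Real.sqrt ((R ^ 2 * (1 + R / 2 + Real.sqrt (R ^ 2 / 4 + 1 / (N : ℝ) ^ 2)) / (2 - 4 / (N : ℝ) ^ 2)) ^ 2 / 4 + (R ^ 2 * (4 / (N : ℝ) ^ 2 + 2 * (R / 2 + Real.sqrt (R ^ 2 / 4 + 1 / (N : ℝ) ^ 2)) ^ 2) /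 (2 - 4 / (N : ℝ) ^ 2)))))
              + (10 * ((N : ℝ) ^ 2 / (2 * ((N : ℝ) ^ 2 - 4))) + 1 / 2) * R * (R ^ 2 / 2 + R * Real.sqrt (R ^ 2 / 4 + 1 / (N : ℝ) ^ 2))) / (1 / 2 - R)) := by
    have h10 : (3 : ℝ) ≤ N := by exact_mod_cast hN3
    have hN4 : (0 : ℝ) < (N : ℝ) ^ 2 - 4 := by nlinarith only [h10]
    have hN1 : (0 : ℝ) < (N : ℝ) ^ 2 - 1 := by nlinarith only [h10]
    have : 0 ≤ (N : ℝ) ^ 2 / ((N : ℝ) ^ 2 - 1) := div_nonneg (by positivity) hN1.le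
    have : 0 ≤ (N : ℝ) ^ 2 / (2 * ((N : ℝ) ^ 2 - 4)) := div_nonneg (by positivity) (by positivity)
    have : 0 < 1 / 2 - R := by linarith only [hR]
    have : 0 ≤ (R * ((R ^ 2 * (1 + R / 2 + Real.sqrt (R ^ 2 / 4 + 1 / (N : ℝ) ^ 2)) / (2 - 4 / (N : ℝ) ^ 2)) / 2 + Real.sqrt ((R ^ 2 * (1 + R / 2 + Real.sqrt (R ^ 2 / 4 + 1 / (N : ℝ) ^ 2)) / (2 - 4 / (N : ℝ) ^ 2)) ^ 2 / 4 + (R ^ 2 * (4 / (N : ℝ) ^ 2 + 2 * (R / 2 + Real.sqrt (R ^ 2 / 4 + 1 / (N : ℝ) ^ 2)) ^ 2) / (2 - 4 / (N : ℝ) ^ 2))))) := tau_nonneg hN3 hR0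
    positivity
  refine hasAreaLaw_of_oneLinkKRModulus durhuusFrohlich_areaLaw_of_slabClustering_holds hd (by omega) hβ hK0 hRdef.symm.le
    (oneLinkKRModulus_levelTwoQ hN3 hR) ?_
  have hnum : ((50 : ℝ) ^ 2 / ((50 : ℝ) ^ 2 - 1)) *
        ((1097 / 1250) + ((50 : ℝ) ^ 2 / (2 * ((50 : ℝ) ^ 2 - 4))) * (5 / 16) + 2 * (((50 : ℝ) ^ 2 / (2 * ((50 : ℝ) ^ 2 - 4))) + 1 / 4) * ((5 / 16) ^ 2 / 2 + (5 / 16) * (197 / 1250))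
          + (3 * ((50 : ℝ) ^ 2 / (2 * ((50 : ℝ) ^ 2 - 4))) * (5 / 16) ^ 2 + (2 * ((50 : ℝ) ^ 2 / (2 * ((50 : ℝ) ^ 2 - 4))) + 1 / 4) * ((5 / 16) * (((5 / 16) ^ 2 * (1 + (5 / 16) / 2 + (197 / 1250)) / (2 - 4 / (50 : ℝ) ^ 2)) / 2 + (5181 / 50000)))
              + (10 * ((50 : ℝ) ^ 2 / (2 * ((50 : ℝ) ^ 2 - 4))) + 1 / 2) * (5 / 16) * ((5 / 16) ^ 2 / 2 + (5 / 16) * (197 / 1250))) / (1 / 2 - (5 / 16))) * (5 / 16) < 1 := by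
    norm_num
  have e : 2 * ((d : ℝ) - 1) * β = R := by rw [hRdef]; ring
  rw [e]
  push_cast at hK
  nlinarith [mul_le_mul hK hRR₀ hR0 (by norm_num), hK0]

/-- `d = 4`: **`SU(N)` Wilson AREA LAW for every `N ≥ 50` at every 't Hooft `0 ≤ β ≤ 5 / 96`** (`0.0521`; tree coupling `N·β`;
printed Cao–Nissim–Sheffield: `β < 1/24 ≈ 0.0417`), hypothesis-free. [cite: CaoNissimSheffield2025dynamical, Theorems 1.6 and 2.3] -/
theorem hasAreaLaw_SU_levelTwoQ_fifty_d4 (hN : 50 ≤ N) {β : ℝ} (hβ : 0 ≤ β) (h : β ≤ 5 / 96) :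
    HasAreaLaw 4 (fundamentalRep (Fin N)) ((N : ℝ) * β) :=
  hasAreaLaw_SU_levelTwoQ_fifty (d := 4) (by norm_num) hN hβ (by norm_num; linarith)

/-- The ladder numbers: `d = 4` thresholds `1/24 < 11/240 < 59/1200 < 61/1200 < 31/600 < 5/96` and the radii. [folklore] -/
theorem areaLaw_numbers_levelTwoQ :
    (1 : ℝ) / 24 < 11 / 240 ∧ (11 : ℝ) / 240 < 59 / 1200 ∧ (59 : ℝ) / 1200 < 61 / 1200 ∧ (61 : ℝ) / 1200 < 31 / 600 ∧
      (31 : ℝ) / 600 < 5 / 96 ∧ (6 : ℝ) * (11 / 240) = 11 / 40 ∧ (6 : ℝ) * (59 / 1200) = 59 / 200 ∧ (6 : ℝ) * (61 / 1200) = 61 / 200 ∧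
      (6 : ℝ) * (31 / 600) = 31 / 100 ∧ (6 : ℝ) * (5 / 96) = 5 / 16 ∧ (11 : ℝ) / 250 < 11 / 240 ∧ (1 : ℝ) / 20 < 31 / 600 := by
  norm_num

end LevelTwoQAreaLaw

end Summit.Ventures.YMGap.OneLinkEigen
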